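import Summits.RiemannHypothesis.RiemannHypothesis.Theorems.GroundBartaGroundBartaFloorCutoffEnergy
import Summits.RiemannHypothesis.RiemannHypothesis.Theorems.WeilGroundStateGroundStatesConvergeToXiEulerLagrange
import Literature.NumberTheory.LFunctions.WeilGroundState
import Literature.NumberTheory.LFunctions.WeilGroundEnergyProofs
import Literature.NumberTheory.LFunctions.WeilGroundStateRealZerosProofs
import Literature.NumberTheory.LFunctions.WeilOddThetaVector
import Literature.NumberTheory.LFunctions.DeBruijnPhiDecreasing
import Literature.Analysis.Calculus.SmoothCutoff
import HarnessLib

/-!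
# Preliminaries for the ground Barta floor (crux `GroundBarta.GroundBartaFloor`,
stmt-RiemannHypothesis-18389; line `outer_cutoff_harmonic_pairing`)

Small facts used by the composition `GroundBartaGroundBartaFloorBarta.lean`:
* the outer cut-off `χ_η = cutoff (a/η + 1) (·/η)`: `= 1` on `[-a, a]`, even, smooth, vanishing
  off `(-(a+η), a+η)`, compactly supported;
* `Φ(a) ≤ Φ(t) ≤ Φ(0)` for `|t| ≤ a` (`Φ = weilThetaPhi` even, decreasing on `[0, ∞)`);
* convolution on the left is insensitive to a.e. modification;
* CAUCHY–SCHWARZ for the shifted form at a window `b`: for tests `f, h` supported in `[-b, b]`,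
  `Re W(f ⋆ h̃) - √q_b(f) √q_b(h) ≤ ε(b) Re⟨f, h⟩`, `q_b(φ) = Re Q(φ) - ε(b)‖φ‖²`
  (`ConnesVanSuijlekom.abs_polar_le` and the hypothesis-free hermitian symmetry
  `weilFunctional_weilConv_weilReflect_swap`; Bombieri 2000 §4 / Connes–van Suijlekom Thm 6.1).
Elementary. [folklore]
-/

set_option linter.dupNamespace false

noncomputable section

open Set MeasureTheory Filter Complex
open scoped Real Topology ComplexConjugate

namespace Summit.RiemannHypothesis.RiemannHypothesis.Theorems.GroundBartaFloor

open Literature.NumberTheory.LFunctions Literature.Analysis.Calculus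
open Summit.RiemannHypothesis.RiemannHypothesis.Theorems.GroundStatesConvergeToXi

/-! ## The outer cut-off `χ_η = cutoff (a/η + 1) (·/η)` -/

section Cutoff

variable {a η : ℝ}

/-- `χ_η = 1` on `[-a, a]`. [folklore] -/
theorem gbf_cutoff_eq_one (hη : 0 < η) {x : ℝ} (hx : x ∈ Icc (-a) a) :
    cutoff (a / η + 1) (x / η) = 1 := by
  apply cutoff_eq_one
  rw [add_sub_cancel_right, abs_div, abs_of_pos hη, div_le_div_iff_of_pos_right hη]
  exact abs_le.2 ⟨hx.1, hx.2⟩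

/-- `χ_η` is even. [folklore] -/
theorem gbf_cutoff_neg (x : ℝ) : cutoff (a / η + 1) (-x / η) = cutoff (a / η + 1) (x / η) := by
  unfold cutoff
  rw [neg_div, mul_comm]
  congr 1 <;> ring_nf

/-- `χ_η` is smooth. [folklore] -/
theorem gbf_contDiff_cutoff : ContDiff ℝ (⊤ : ℕ∞) (fun x : ℝ => cutoff (a / η + 1) (x / η)) :=
  (contDiff_cutoff _).comp (contDiff_id.div_const η)

/-- `χ_η` vanishes off `(-(a+η), a+η)`. [folklore] -/
theorem gbf_cutoff_eq_zero_of_not_mem (hη : 0 < η) {x : ℝ} (hx : x ∉ Ioo (-(a + η)) (a + η)) :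
    cutoff (a / η + 1) (x / η) = 0 := by
  apply cutoffEnergy_cutoff_eq_zero hη
  simp only [mem_Ioo, not_and_or, not_lt] at hx
  rcases hx with h | h
  · exact (by linarith : a + η ≤ -x).trans (neg_le_abs x)
  · exact h.trans (le_abs_self x)

/-- `χ_η` has compact support. [folklore] -/
theorem gbf_hasCompactSupport_cutoff (hη : 0 < η) :
    HasCompactSupport (fun x : ℝ => cutoff (a / η + 1) (x / η)) :=
  HasCompactSupport.intro (isCompact_Icc (a := -(a + η)) (b := a + η)) fun _ hx =>
    gbf_cutoff_eq_zero_of_not_mem hη fun h => hx (Ioo_subset_Icc_self h)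

end Cutoff

/-! ## Riemann's kernel on the window -/

/-- `Φ(a) ≤ Φ(t)` for `|t| ≤ a` (`Φ` even and decreasing on `[0, ∞)`). [folklore] -/
theorem gbf_weilThetaPhi_le_of_abs_le {a t : ℝ} (h : |t| ≤ a) : weilThetaPhi a ≤ weilThetaPhi t := by
  have ht : weilThetaPhi t = weilThetaPhi |t| := by
    rcases le_or_gt 0 t with h0 | h0
    · rw [abs_of_nonneg h0]
    · rw [abs_of_neg h0, weilThetaPhi_neg]
  rw [ht]
  exact strictAntiOn_weilThetaPhi.antitoneOn (show |t| ∈ Ici (0 : ℝ) from abs_nonneg t)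
    (show a ∈ Ici (0 : ℝ) from (abs_nonneg t).trans h) h

/-- `Φ(t) ≤ Φ(0)`. [folklore] -/
theorem gbf_weilThetaPhi_le_zero_val (t : ℝ) : weilThetaPhi t ≤ weilThetaPhi 0 := by
  rcases eq_or_ne t 0 with rfl | h0
  · exact le_rfl
  · exact (weilThetaPhi_lt_weilThetaPhi_zero h0).le

/-! ## Small measure-theoretic facts -/

/-- Convolution on the left is insensitive to a.e. modification. [folklore] -/
theorem gbf_weilConv_congr_ae_left {u v : ℝ → ℂ} (h : u =ᵐ[volume] v) (k : ℝ → ℂ) :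
    weilConv u k = weilConv v k := by
  funext x
  rw [weilConv_apply, weilConv_apply]
  exact integral_congr_ae (h.mono fun s hs => by simp only [hs])

/-! ## Cauchy–Schwarz at a window -/

/-- **Cauchy–Schwarz for the shifted form at the window `b`**: for tests `f, h` supported in
`[-b, b]`, `Re W(f ⋆ h̃) - √q_b(f) √q_b(h) ≤ ε(b) Re⟨f, h⟩`, `q_b(φ) = Re Q(φ) - ε(b)‖φ‖²`
(`ConnesVanSuijlekom.abs_polar_le` + hermitian symmetry). [folklore] -/
theorem gbf_re_weilFunctional_sub_sqrt_le {b : ℝ} {f h : ℝ → ℂ} (hf : IsWeilTest f)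
    (hfs : tsupport f ⊆ Icc (-b) b) (hh : IsWeilTest h) (hhs : tsupport h ⊆ Icc (-b) b) :
    (weilFunctional (weilConv f (weilReflect h))).re -
        Real.sqrt ((weilQuadratic f).re - weilGroundEnergy b * ∫ x, ‖f x‖ ^ 2) *
          Real.sqrt ((weilQuadratic h).re - weilGroundEnergy b * ∫ x, ‖h x‖ ^ 2) ≤
      weilGroundEnergy b * (∫ t, f t * conj (h t)).re := by
  set ε := weilGroundEnergy b with hε
  have hcs := ConnesVanSuijlekom.abs_polar_le hf hfs hh hhs
  have e1 := ConnesVanSuijlekom.re_weilQuadratic_add_real_mul hf hh 1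
  have e2 := ConnesVanSuijlekom.integral_norm_sq_add_real_mul hf hh 1
  have hone : (f + fun x => ((1 : ℝ) : ℂ) * h x) = f + h := by
    funext x
    simp
  rw [hone] at e1 e2
  have key : ((weilQuadratic (f + h)).re - ε * ∫ x, ‖(f + h) x‖ ^ 2) -
      ((weilQuadratic f).re - ε * ∫ x, ‖f x‖ ^ 2) -
      ((weilQuadratic h).re - ε * ∫ x, ‖h x‖ ^ 2) =
      2 * ((weilFunctional (weilConv f (weilReflect h))).re - ε * (∫ t, f t * conj (h t)).re) := by
    rw [e1, e2, weilFunctional_weilConv_weilReflect_swap f h]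
    simp only [Complex.add_re, Complex.conj_re]
    ring
  rw [key] at hcs
  have h2 := (abs_le.1 hcs).2
  nlinarith [h2, Real.sqrt_nonneg ((weilQuadratic f).re - ε * ∫ x, ‖f x‖ ^ 2),
    Real.sqrt_nonneg ((weilQuadratic h).re - ε * ∫ x, ‖h x‖ ^ 2)]

end Summit.RiemannHypothesis.RiemannHypothesis.Theorems.GroundBartaFloor

end
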